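import Literature.NumberTheory.Automorphic.GL2CESHPrimitiveFunction
import Literature.NumberTheory.Automorphic.GL2CCuspFormLowestKType
import Literature.NumberTheory.Automorphic.KugaDegreeOneInjectivity
import HarnessLib

/-!
# Non-vanishing of the Eichler–Shimura–Harder class of a clean Bianchi cusp form

Let `D : GL2CESH.FamilyData K hcpt` (`GL2CESHFamilyDeriv`): a clean cuspidal `π` of
`GL₂(𝔸_K)`, `K` imaginary quadratic, with its closed `1`-cochain `η` of Kuga's relative complex
(`GL2CESHModel.eshCochain_model`) and the resulting automorphic family of closed `E_λ(ℂ)`-valued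
`1`-forms on `GL₂(ℂ)` (`GL2CESHFamily`, `isAutomorphicFamily`), whose van Est class
`GL2C.vanEstClass` lies in `H¹(S_{K_f}, E_λ(ℂ))`.  We prove Harder's non-vanishing statement in
Borel's form: **if the van Est class vanishes then `η = 0`** (`eta_eq_zero_of_vanEstClass_eq_zero`),
given a unitary twist `|det|^s` of `π` compatible with the central character of `E_λ`
(`χ(det a) = a^{κ}` on `A_G`) and `δη = 0`.

The argument is Kuga's (`Kuga.Setup.eq_zero_of_pairedPrimitive`): a vanishing class has an
automorphic primitive `m` (`GL2C.exists_automorphic_primitive_of_vanEstClass_eq_zero`), whence the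
untwisted primitive `Ψ = E(x_∞)⁻¹(F − m)` on `GL₂(𝔸_K)` (`GL2CESHPrimitiveFunction`); its twisted
coordinates descend to the automorphic quotient, are continuous, smooth and of moderate growth in the
archimedean variable, and satisfy `X_i Ψ = η_i − ρ_E(x_i) Ψ` along `𝔭`.  Pairing against the cusp
forms of `W ⊗ |det|^s` by the Petersson integral (`CuspidalPeterssonForm`) gives a paired primitive:
integration by parts is Borel's lemma with archimedean moderate growth
(`AutomorphicLieDerivSkewAdjointArchGrowth`), admissibility of the coefficient operators is
`GL2CESHModel.coeff_adjoint` read pointwise.  Hence `∑ ‖η_i‖² = ⟪Ψ, δη⟫ = 0`.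
[cite: Harder1987, §3.1–3.2] [cite: Borel1997, 11.12] [cite: BorelWallach2000, II §2 and VII §2.2]

Theorems only (and the bodied pairing `pairing`); no named fact.
-/

noncomputable section

-- Mathlib idiom (Mathlib/Algebra/Lie/OfAssociative.lean), as in `GL2CCuspFormOps`.
attribute [local instance 100] LieRing.ofAssociativeRing

open scoped Matrix ComplexConjugate MatrixGroups Topology Matrix.Norms.Operator ContDiff BigOperators NNReal ENNReal Pointwise
open Complex Filter Finset
open _root_.MeasureTheory _root_.MeasureTheory.Measure

namespace Literature.NumberTheory.Automorphic

namespace GL2CESH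

namespace FamilyData

open scoped Classical
open _root_.NumberField _root_.NumberField.InfinitePlace _root_.NumberField.mixedEmbedding IsDedekindDomain
open RealMatrixGroup ComplexPlace ImaginaryQuadratic GL2CCoeff GL2CAut GL2CKType GL2CCuspForm GL2C
open AutomorphicRepData GLnComplexCasimir GL2ComplexCasimir GL2CESHMat Matrix ResGLnCohomology GLnCohomology Sl2Coord
open Literature.NumberTheory.DiophantineGeometry Literature.NumberTheory.GaloisRepresentations

variable {K : Type} [Field K] [NumberField K] [IsTotallyComplex K] {hcpt : isCompact_glFiniteIntegralLevel 2 K}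
  (D : FamilyData K hcpt)

/-! ### Integrability of `Ψ̄ · (cusp form)` on the automorphic quotient -/

omit [IsTotallyComplex K] in
/-- **A continuous function of archimedean moderate growth (locally uniformly in the finite variable)
times a cusp form is integrable on the automorphic quotient** (Siegel domination of the automorphic
measure, the weight of `exists_weight_of_archModerateGrowth`, rapid decay of cusp forms).
[cite: Borel1997, 11.12] [cite: MoeglinWaldspurger1995, I.2.2] -/
theorem integrable_conj_mul_cuspFormsGL {μ : Measure (AdelicGroupData.gl 2 K).automorphicQuotient}
    [(AdelicGroupData.gl 2 K).IsAutomorphicMeasure μ]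
    {f g : (AdelicGroupData.gl 2 K).automorphicQuotient → ℂ} (hfc : Continuous f)
    (hfm : ∀ C : Set (GL (Fin 2) (FiniteAdeleRing (𝓞 K) K)), IsCompact C →
      ∃ (A : ℝ) (r : ℕ), ∀ g' : (AdelicGroupData.gl 2 K).Adelic, GLn.sndHom 2 K g' ∈ C →
        ‖invQuot (AdelicGroupData.gl 2 K) f g'‖ ≤ A * (1 ⊔ (GLn.archHeight 2 K g' : ℝ)) ^ r)
    (hg : invQuot (AdelicGroupData.gl 2 K) g ∈ cuspFormsGL 2 K hcpt) :
    Integrable (fun y => conj (f y) * g y) μ := by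
  letI : MeasurableSpace (GL (Fin 2) (AdeleRing (𝓞 K) K)) := borel _
  haveI : BorelSpace (GL (Fin 2) (AdeleRing (𝓞 K) K)) := ⟨rfl⟩
  haveI : T2Space (GL (Fin 2) (AdeleRing (𝓞 K) K)) := t2Space_gl 2 K
  haveI : LocallyCompactSpace (GL (Fin 2) (AdeleRing (𝓞 K) K)) :=
    AdelicGroupData.locallyCompactSpace_generalLinearGroup_adeleRing K (Fin 2)
  set μG : Measure (GL (Fin 2) (AdeleRing (𝓞 K) K)) := haar with hμG
  obtain ⟨c, Ω, t, Z, hc, ht, hΩc, hΩB, hZc, hZ, hle⟩ :=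
    exists_lintegral_le_mul_setLIntegral_siegel 2 K μ μG
  set Cf : Set (GL (Fin 2) (FiniteAdeleRing (𝓞 K) K)) := GLn.sndHom 2 K '' Ω *
    (glFiniteIntegralLevel 2 K : Set (GL (Fin 2) (FiniteAdeleRing (𝓞 K) K))) with hCf
  have hCfc : IsCompact Cf := isCompact_sndHom_image_mul_glFiniteIntegralLevel hcpt hΩc
  obtain ⟨w, Cst, R, hwc, hw0, hwf, -, hwle⟩ :=
    exists_weight_of_archModerateGrowth (hcpt := hcpt) two_pos (0 : (AutomorphyDatum.gl 2 K hcpt).arch.lie)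
      hfc hfc (hfm Cf hCfc) (hfm Cf hCfc)
  have hwS : ∀ x ∈ Z * (Ω * siegelCone 2 K t *
      (standardMaximalCompactGL 2 K : Set (GL (Fin 2) (AdeleRing (𝓞 K) K)))),
      w ((AdelicGroupData.gl 2 K).toAutomorphicQuotient x⁻¹) ≤ Cst * (1 ⊔ adelicHeightGL 2 K x) ^ R :=
    fun x hx ↦ hwle x (sndHom_mem_of_mem_mul_siegelSet hZ hx)
  -- the cusp-form side
  have hAG : ∀ z ∈ (AdelicGroupData.gl 2 K).center', ∀ x,
      invQuot (AdelicGroupData.gl 2 K) g (z * x) = invQuot (AdelicGroupData.gl 2 K) g x :=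
    fun _ hz x ↦ invQuot_mul_left (AdelicGroupData.gl 2 K) g ((AdelicGroupData.gl 2 K).center'_le_quotientSubgroup hz) x
  have hgc : Continuous (invQuot (AdelicGroupData.gl 2 K) g) :=
    continuous_of_mem_automorphicForms_gl (cuspFormsGL_le_automorphicForms 2 K hcpt hg)
  have hgrd : IsRapidlyDecreasingGL 2 K (invQuot (AdelicGroupData.gl 2 K) g) :=
    (isCuspFormGL_of_mem_cuspFormsGL' hg).isRapidlyDecreasingGL_of_center' hAG
  have hint : Integrable (fun y => w y * ‖g y‖) μ :=
    integrable_weight_mul_norm_of_le_on_siegelSet two_pos μG hc hΩc hΩB ht hZc hZ hle hwc hw0 hwS hgc hgrd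
  -- `|f| ≤ w`
  have hfw : ∀ y, ‖f y‖ ≤ w y := fun y => by
    have := hwf 0 (by norm_num) y
    rwa [zero_smul, RealMatrixGroup.expMem_zero', map_one, one_smul] at this
  have hgq : Continuous g := continuous_of_continuous_invQuot hgc
  refine hint.mono' ((Complex.continuous_conj.comp hfc).mul hgq).aestronglyMeasurable (ae_of_all _ fun y => ?_)
  rw [norm_mul, Complex.norm_conj]
  exact mul_le_mul_of_nonneg_right (hfw y) (norm_nonneg _)

/-! ### `L ∘ Ψ` for a linear functional `L` -/

variable {D}

/-- `x ↦ L (Ψ x)`. [folklore] -/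
def PsiL (m : BigHeckeGLn.FiniteAdelicGL 2 K ⧸ ResGLnCohomology.level 2 K D.𝔫 → ResGLnCohomology.CoeffModule ℂ 2 K D.lam)
    (L : ResGLnCohomology.CoeffModule ℂ 2 K D.lam →ₗ[ℂ] ℂ) (x : GL (Fin 2) (AdeleRing (𝓞 K) K)) : ℂ :=
  L (D.Psi m x)

/-- Unfolding. [folklore] -/
theorem PsiL_apply (m : BigHeckeGLn.FiniteAdelicGL 2 K ⧸ ResGLnCohomology.level 2 K D.𝔫 → ResGLnCohomology.CoeffModule ℂ 2 K D.lam)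
    (L : ResGLnCohomology.CoeffModule ℂ 2 K D.lam →ₗ[ℂ] ℂ) (x : GL (Fin 2) (AdeleRing (𝓞 K) K)) :
    D.PsiL m L x = L (D.Psi m x) := rfl

/-- **The twist of `L ∘ Ψ` is invariant under `A_G · GL₂(K)`** when `χ(det a) = a^{κ}` on `A_G`.
[cite: Harder1987, §3.1] -/
theorem mulChar_PsiL_invariant (h2 : Module.finrank ℚ K = 2)
    {m : BigHeckeGLn.FiniteAdelicGL 2 K ⧸ ResGLnCohomology.level 2 K D.𝔫 → ResGLnCohomology.CoeffModule ℂ 2 K D.lam}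
    (hm : D.PrimRel m) {χ : HeckeCharacter K}
    (hχ : ∀ t : ℝ≥0ˣ, ((detTwist 2 χ (posRealScalar 2 K t) : ℂˣ) : ℂ) = (((t : ℝ≥0) : ℝ) : ℂ) ^ centralExp D.lam)
    (L : ResGLnCohomology.CoeffModule ℂ 2 K D.lam →ₗ[ℂ] ℂ) :
    ∀ γ ∈ (AdelicGroupData.gl 2 K).quotientSubgroup, ∀ x,
      mulChar (detTwist 2 χ) (D.PsiL m L) (γ * x) = mulChar (detTwist 2 χ) (D.PsiL m L) x := by
  refine (AdelicGroupData.gl 2 K).leftInvariant_quotientSubgroup ?_ ?_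
  · intro γ hγ x
    have h1 : detTwist 2 χ γ = 1 := detTwist_eq_one_of_mem_arithmeticSubgroup 2 χ hγ
    obtain ⟨γ₀, rfl⟩ := hγ
    have hP : D.Psi m ((AdelicGroupData.gl 2 K).toAdelic γ₀ * x) = D.Psi m x := Psi_map_algebraMap_mul h2 hm γ₀ x
    rw [mulChar_apply, mulChar_apply, map_mul, h1, one_mul, PsiL_apply, PsiL_apply, hP]
  · rintro _ ⟨t, rfl⟩ x
    have ht : (((t : ℝ≥0) : ℝ) : ℂ) ≠ 0 :=
      Complex.ofReal_ne_zero.2 (NNReal.coe_pos.2 (pos_iff_ne_zero.2 t.ne_zero)).ne'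
    have hc : (((t : ℝ≥0) : ℝ) : ℂ) ^ centralExp D.lam ≠ 0 := zpow_ne_zero _ ht
    rw [mulChar_apply, mulChar_apply, map_mul, Units.val_mul, hχ, PsiL_apply, PsiL_apply]
    have hP : ∀ y : (AdelicGroupData.gl 2 K).Adelic, y = posRealScalar 2 K t →
        D.Psi m (y * x) = ((((t : ℝ≥0) : ℝ) : ℂ) ^ centralExp D.lam)⁻¹ • D.Psi m x := by
      rintro _ rfl
      exact Psi_posRealScalar_mul h2 m t x
    rw [hP _ rfl, LinearMap.map_smul, smul_eq_mul]
    field_simp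

/-- **`L ∘ Ψ` is smooth in the archimedean variable.** [cite: Harder1987, §3.1] -/
theorem isArchSmooth_PsiL (h2 : Module.finrank ℚ K = 2)
    (m : BigHeckeGLn.FiniteAdelicGL 2 K ⧸ ResGLnCohomology.level 2 K D.𝔫 → ResGLnCohomology.CoeffModule ℂ 2 K D.lam)
    (L : ResGLnCohomology.CoeffModule ℂ 2 K D.lam →ₗ[ℂ] ℂ) :
    IsArchSmooth (AutomorphyDatum.gl 2 K hcpt).ofArch (D.PsiL m L) := by
  refine isArchSmooth_of_contDiffOn_complex K h2 fun c => ?_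
  exact (LinearMap.toContinuousLinearMap (L.restrictScalars ℝ)).contDiff.comp_contDiffOn (D.contDiffOn_Psi_pt h2 m c)

/-- **`L ∘ Ψ` is continuous.** [folklore] -/
theorem continuous_PsiL (h2 : Module.finrank ℚ K = 2)
    (m : BigHeckeGLn.FiniteAdelicGL 2 K ⧸ ResGLnCohomology.level 2 K D.𝔫 → ResGLnCohomology.CoeffModule ℂ 2 K D.lam)
    (L : ResGLnCohomology.CoeffModule ℂ 2 K D.lam →ₗ[ℂ] ℂ) : Continuous (D.PsiL m L) := by
  set F : GL (Fin 2) ℂ → BigHeckeGLn.FiniteAdelicGL 2 K ⧸ ResGLnCohomology.level 2 K D.𝔫 → ℂ := fun g q =>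
    L (coeffRepC K D.lam g⁻¹ (D.prim q g - m q)) with hF
  have hco : D.PsiL m L = fun x => F (toComplexGL K 2 x) (QuotientGroup.mk (GLn.sndHom 2 K x)) := rfl
  rw [hco]
  refine continuous_of_coset K (L := ResGLnCohomology.level 2 K D.𝔫) D.isOpen_level F fun q => ?_
  have hsm : ContDiffOn ℝ ∞ (fun M : Mat => coeffRepC K D.lam (toGL M⁻¹) (GL2C.primitive (D.family q.out) M - m q)) GL2C.Inv :=
    contDiffOn_coeffRepC_inv_apply h2
      ((contDiffOn_primitive_infty (D.isCochain_family h2 _) fun j => D.contDiffOn_family h2 _ _).sub contDiffOn_const)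
  have heq : (fun g : GL (Fin 2) ℂ => F g q) = (fun v => L v) ∘
      (fun M : Mat => coeffRepC K D.lam (toGL M⁻¹) (GL2C.primitive (D.family q.out) M - m q)) ∘
        fun g : GL (Fin 2) ℂ => (g : Mat) := by
    funext g
    simp only [hF, Function.comp_apply, prim]
    rw [toGL_nonsing_inv (isUnit_det_coe g), toGL_coe]
  rw [heq]
  refine (LinearMap.toContinuousLinearMap (L.restrictScalars ℝ)).continuous.comp ?_
  exact hsm.continuousOn.comp_continuous Units.continuous_val fun g => isUnit_det_coe g

/-- **The twist of `L ∘ Ψ` has moderate growth in the archimedean variable, locally uniformly in the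
finite variable.** [cite: BorelWallach2000, VII §2.2 and XIV 2.3] -/
theorem PsiL_twist_archModerateGrowth (h2 : Module.finrank ℚ K = 2)
    (m : BigHeckeGLn.FiniteAdelicGL 2 K ⧸ ResGLnCohomology.level 2 K D.𝔫 → ResGLnCohomology.CoeffModule ℂ 2 K D.lam)
    {χ : HeckeCharacter K} {s : ℂ}
    (hχ : ∀ x : ideleGroup K, ((χ x : ℂˣ) : ℂ) = (GaloisRepresentations.ideleNorm x : ℂ) ^ s)
    (L : ResGLnCohomology.CoeffModule ℂ 2 K D.lam →ₗ[ℂ] ℂ)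
    (C : Set (BigHeckeGLn.FiniteAdelicGL 2 K)) (hC : IsCompact C) :
    ∃ (A : ℝ) (r : ℕ), ∀ x : GL (Fin 2) (AdeleRing (𝓞 K) K), GLn.sndHom 2 K x ∈ C →
      ‖mulChar (detTwist 2 χ) (D.PsiL m L) x‖ ≤ A * (1 ⊔ (GLn.archHeight 2 K x : ℝ)) ^ r := by
  obtain ⟨r, a, ha0, hΨ⟩ := D.exists_norm_Psi_le h2 m
  obtain ⟨C₀, k, hC₀, hdet⟩ := exists_norm_detTwist_le (K := K) hχ
  set Lℝ := LinearMap.toContinuousLinearMap (L.restrictScalars ℝ) with hLℝ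
  refine archModerateGrowth_of_coset_bound h2 D.isOpen_level (Φ := mulChar (detTwist 2 χ) (D.PsiL m L))
    (fun q => C₀ * ‖Lℝ‖ * a q) r k (fun g c => ?_) C hC
  rw [mulChar_apply, norm_mul, PsiL_apply]
  change ‖((detTwist 2 χ (pt K g c) : ℂˣ) : ℂ)‖ * ‖Lℝ (D.Psi m (pt K g c))‖ ≤ _
  have h1 := hdet (pt K g c)
  have h2' := Lℝ.le_opNorm (D.Psi m (pt K g c))
  have h3 := hΨ g c
  have h0 : 0 ≤ 1 ⊔ adelicHeightGL 2 K (pt K g c) := zero_le_one.trans le_sup_left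
  calc ‖((detTwist 2 χ (pt K g c) : ℂˣ) : ℂ)‖ * ‖Lℝ (D.Psi m (pt K g c))‖
      ≤ (C₀ * (1 ⊔ adelicHeightGL 2 K (pt K g c)) ^ k) * (‖Lℝ‖ * (a (QuotientGroup.mk c) * (1 + ‖(g : Mat)‖ + ‖(g : Mat)⁻¹‖) ^ r)) :=
        mul_le_mul h1 (h2'.trans (mul_le_mul_of_nonneg_left h3 (norm_nonneg _))) (norm_nonneg _)
          (mul_nonneg hC₀ (pow_nonneg h0 _))
    _ = C₀ * ‖Lℝ‖ * a (QuotientGroup.mk c) * (1 + ‖(g : Mat)‖ + ‖(g : Mat)⁻¹‖) ^ r * (1 ⊔ adelicHeightGL 2 K (pt K g c)) ^ k := by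
        ring

/-- **The Lie derivative of `L ∘ Ψ` along `X ∈ 𝔭`**: `L (Θ(η(X)) − dE(φ_{w₀} X) Ψ)`. [cite: Harder1987, §3.1] -/
theorem lieDeriv_PsiL (h2 : Module.finrank ℚ K = 2)
    (m : BigHeckeGLn.FiniteAdelicGL 2 K ⧸ ResGLnCohomology.level 2 K D.𝔫 → ResGLnCohomology.CoeffModule ℂ 2 K D.lam)
    (L : ResGLnCohomology.CoeffModule ℂ 2 K D.lam →ₗ[ℂ] ℂ) {X : Mat} (hX : IsHT X) (x : (AdelicGroupData.gl 2 K).Adelic) :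
    lieDeriv (AutomorphyDatum.gl 2 K hcpt).ofArch (placeLie 2 (complexPlace K) X) (D.PsiL m L) x =
      L (D.vec X x - coeffPlaceLie K D.lam (complexPlace K) X (D.Psi m x)) := by
  have hK : Subsingleton (InfinitePlace K) := subsingleton_infinitePlace K h2
  set g := toComplexGL K 2 x with hg
  set c := GLn.sndHom 2 K x with hc
  have hxe : pt K g c = x := pt_toComplexGL_sndHom K h2 x
  have hflow := hasDerivAt_pt_mul_expGL hK (D.isArchSmooth_PsiL h2 m L) g c X
  have hours : HasDerivAt (fun s : ℝ => D.PsiL m L (pt K (g * expGL (s • X)) c))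
      (L (D.vec X (pt K g c) - coeffPlaceLie K D.lam (complexPlace K) X (D.Psi m (pt K g c)))) 0 :=
    (LinearMap.toContinuousLinearMap (L.restrictScalars ℝ)).hasFDerivAt.comp_hasDerivAt 0
      (D.hasDerivAt_Psi_pt_mul_expGL h2 m g c hX)
  have heq := hflow.unique hours
  rwa [hxe] at heq

/-! ### The twist `|det|^s`: norm exponent zero along `𝔭₀` -/

/-- The norm exponent of `φ_{w₀}(x_i)` vanishes (`tr x_i = 0`). [folklore] -/
theorem normExponent_placeLie_Xmat (i : Fin 3) :
    ((∑ w', ((placeLie 2 (complexPlace K) (Xmat i) : (archGroupGL 2 K).lie) :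
        Matrix (Fin 2) (Fin 2) (mixedSpace K)).trace.1 w') +
      ∑ w', 2 * (((placeLie 2 (complexPlace K) (Xmat i) : (archGroupGL 2 K).lie) :
        Matrix (Fin 2) (Fin 2) (mixedSpace K)).trace.2 w').re) = 0 := by
  rw [coe_placeLie, normExponent_complexPlaceLie, (isHT_Xmat i).2, Complex.zero_re, mul_zero]

/-- **`X_i (|det|^s · L∘Ψ) = |det|^s · X_i (L∘Ψ)`** along `𝔭₀`. [cite: BorelJacquet1979, §1.5 and 5.7] -/
theorem lieDeriv_mulChar_PsiL (h2 : Module.finrank ℚ K = 2)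
    (m : BigHeckeGLn.FiniteAdelicGL 2 K ⧸ ResGLnCohomology.level 2 K D.𝔫 → ResGLnCohomology.CoeffModule ℂ 2 K D.lam)
    {χ : HeckeCharacter K} {s : ℂ}
    (hχ : ∀ x : ideleGroup K, ((χ x : ℂˣ) : ℂ) = (GaloisRepresentations.ideleNorm x : ℂ) ^ s)
    (L : ResGLnCohomology.CoeffModule ℂ 2 K D.lam →ₗ[ℂ] ℂ) (i : Fin 3) :
    lieDeriv (AutomorphyDatum.gl 2 K hcpt).ofArch (placeLie 2 (complexPlace K) (Xmat i))
        (mulChar (detTwist 2 χ) (D.PsiL m L)) =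
      mulChar (detTwist 2 χ) (fun x => L (D.vec (Xmat i) x - coeffPlaceLie K D.lam (complexPlace K) (Xmat i) (D.Psi m x))) := by
  obtain ⟨lam, -, hlam⟩ := exists_normExponent (n := 2) (K := K) hcpt
  have hlamX : lam (placeLie 2 (complexPlace K) (Xmat i)) = 0 := by rw [hlam]; exact normExponent_placeLie_Xmat i
  haveI : FiniteDimensional ℝ (mixedSpace K) := inferInstance
  rw [lieDeriv_mulChar_of_exp _ (detTwist_ofArch_expMem_eq_exp_smul hχ hlam) _ (D.isArchSmooth_PsiL h2 m L)]
  have hzero : (s • (Complex.ofRealAm.toLinearMap.comp lam)) (placeLie 2 (complexPlace K) (Xmat i)) = 0 := by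
    rw [LinearMap.smul_apply, LinearMap.comp_apply, hlamX]; simp
  rw [hzero, zero_smul, add_zero]
  congr 1
  funext x
  exact D.lieDeriv_PsiL h2 m L (isHT_Xmat i) x

/-- **`X_i (|det|^s · φ) = |det|^s · ρ₁(x_i) φ`** for `φ ∈ W`. [cite: BorelJacquet1979, §1.5 and 5.7] -/
theorem lieDeriv_mulChar_W {χ : HeckeCharacter K} {s : ℂ}
    (hχ : ∀ x : ideleGroup K, ((χ x : ℂˣ) : ℂ) = (GaloisRepresentations.ideleNorm x : ℂ) ^ s)
    (i : Fin 3) (φ : D.π.W) :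
    lieDeriv (AutomorphyDatum.gl 2 K hcpt).ofArch (placeLie 2 (complexPlace K) (Xmat i))
        (mulChar (detTwist 2 χ) (φ : (AdelicGroupData.gl 2 K).Adelic → ℂ)) =
      mulChar (detTwist 2 χ) ((D.ρ₁ (Xmat i) φ : D.π.W) : (AdelicGroupData.gl 2 K).Adelic → ℂ) := by
  obtain ⟨lam, -, hlam⟩ := exists_normExponent (n := 2) (K := K) hcpt
  have hlamX : lam (placeLie 2 (complexPlace K) (Xmat i)) = 0 := by rw [hlam]; exact normExponent_placeLie_Xmat i
  rw [D.π.lieDeriv_mulChar_detTwist_of_cpow hχ hlam, hlamX, Complex.ofReal_zero, mul_zero, zero_smul, add_zero, coe_ρ₁]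
  rfl

/-! ### Closure of archimedean moderate growth under differences -/

omit [IsTotallyComplex K] in
/-- Differences of functions of archimedean moderate growth (locally uniformly in the finite variable)
have the same growth. [folklore] -/
theorem archMG_sub {u v : (AdelicGroupData.gl 2 K).Adelic → ℂ}
    (hu : ∀ C : Set (GL (Fin 2) (FiniteAdeleRing (𝓞 K) K)), IsCompact C →
      ∃ (A : ℝ) (r : ℕ), ∀ g' : (AdelicGroupData.gl 2 K).Adelic, GLn.sndHom 2 K g' ∈ C →
        ‖u g'‖ ≤ A * (1 ⊔ (GLn.archHeight 2 K g' : ℝ)) ^ r)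
    (hv : ∀ C : Set (GL (Fin 2) (FiniteAdeleRing (𝓞 K) K)), IsCompact C →
      ∃ (A : ℝ) (r : ℕ), ∀ g' : (AdelicGroupData.gl 2 K).Adelic, GLn.sndHom 2 K g' ∈ C →
        ‖v g'‖ ≤ A * (1 ⊔ (GLn.archHeight 2 K g' : ℝ)) ^ r)
    (C : Set (GL (Fin 2) (FiniteAdeleRing (𝓞 K) K))) (hC : IsCompact C) :
    ∃ (A : ℝ) (r : ℕ), ∀ g' : (AdelicGroupData.gl 2 K).Adelic, GLn.sndHom 2 K g' ∈ C →
      ‖(u - v) g'‖ ≤ A * (1 ⊔ (GLn.archHeight 2 K g' : ℝ)) ^ r := by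
  obtain ⟨A₁, r₁, h₁⟩ := hu C hC
  obtain ⟨A₂, r₂, h₂⟩ := hv C hC
  refine ⟨|A₁| + |A₂|, max r₁ r₂, fun g' hg' => ?_⟩
  set H : ℝ := 1 ⊔ (GLn.archHeight 2 K g' : ℝ) with hH
  have hH1 : 1 ≤ H := le_sup_left
  have e₁ : ‖u g'‖ ≤ |A₁| * H ^ max r₁ r₂ :=
    (h₁ g' hg').trans (mul_le_mul (le_abs_self _) (pow_le_pow_right₀ hH1 (le_max_left _ _))
      (pow_nonneg (zero_le_one.trans hH1) _) (abs_nonneg _))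
  have e₂ : ‖v g'‖ ≤ |A₂| * H ^ max r₁ r₂ :=
    (h₂ g' hg').trans (mul_le_mul (le_abs_self _) (pow_le_pow_right₀ hH1 (le_max_right _ _))
      (pow_nonneg (zero_le_one.trans hH1) _) (abs_nonneg _))
  calc ‖(u - v) g'‖ = ‖u g' - v g'‖ := rfl
    _ ≤ ‖u g'‖ + ‖v g'‖ := norm_sub_le _ _
    _ ≤ |A₁| * H ^ max r₁ r₂ + |A₂| * H ^ max r₁ r₂ := add_le_add e₁ e₂
    _ = (|A₁| + |A₂|) * H ^ max r₁ r₂ := by ring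

/-! ### The positive form `ū v` on `ℂ` and admissibility of the coefficient operators -/

omit [IsTotallyComplex K] in
/-- `⟪u, v⟫ = ū v` is a positive definite Hermitian form on `ℂ`. [folklore] -/
theorem isPosForm_conj_mul : Kuga.IsPosForm (fun u v : ℂ => conj u * v) where
  add_left x y z := by rw [map_add, add_mul]
  smul_left c x y := by rw [smul_eq_mul, map_mul, mul_assoc]
  conj_symm x y := by rw [map_mul, Complex.conj_conj, mul_comm]
  nonneg x := by rw [Complex.conj_mul', ← Complex.ofReal_pow, Complex.ofReal_re]; positivity
  definite x hx := by
    rcases mul_eq_zero.1 hx with h | h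
    · exact (map_eq_zero (starRingEnd ℂ)).1 h
    · exact h

/-- **The `𝔭`-operators of the coefficient family are self-adjoint for the weighted form
`∑ g_l g_m ū_{lm} v_{lm}`** (`coeff_adjoint` through `skew_and_symm`). [cite: BorelWallach2000, II §2.2] -/
theorem ipModel_pVec_coeff_symm (d : ℕ) (i : Fin 3) (a b : model ℂ d) :
    ipModel d (fun u v : ℂ => conj u * v) ((coeff (C := ℂ) d).pVec i a) b =
      ipModel d (fun u v : ℂ => conj u * v) a ((coeff (C := ℂ) d).pVec i b) := by
  have hipM := isPosForm_ipModel d isPosForm_conj_mul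
  obtain ⟨hLE, hLH, hRE, hRH⟩ := coeff_adjoint (C := ℂ) d isPosForm_conj_mul
  set O₀ : Ops (model ℂ d) := ⟨0, 0, 0, 0, 0, 0⟩ with hO₀
  have h0 : ∀ x y : model ℂ d, ipModel d (fun u v : ℂ => conj u * v) ((0 : Module.End ℂ (model ℂ d)) x) y =
      -ipModel d (fun u v : ℂ => conj u * v) x ((0 : Module.End ℂ (model ℂ d)) y) := fun x y => by
    rw [LinearMap.zero_apply, LinearMap.zero_apply, hipM.zero_left, hipM.zero_right, neg_zero]
  exact (GL2CKType.skew_and_symm (O₁ := O₀) (O₂ := coeff (C := ℂ) d) hipM h0 h0 h0 hLE hLH hRE hRH).2 i a b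

/-! ### The paired primitive -/

section Pairing

/-- **The twisted functional coordinates of `Ψ` on the automorphic quotient.** [cite: Harder1987, §3.1] -/
def PsiQ (h2 : Module.finrank ℚ K = 2) (T : UnitaryTwist D.π) {m : BigHeckeGLn.FiniteAdelicGL 2 K ⧸ ResGLnCohomology.level 2 K D.𝔫 → ResGLnCohomology.CoeffModule ℂ 2 K D.lam} (hm : D.PrimRel m)
    (hχκ : ∀ t : ℝ≥0ˣ, ((detTwist 2 T.χ (posRealScalar 2 K t) : ℂˣ) : ℂ) = (((t : ℝ≥0) : ℝ) : ℂ) ^ centralExp D.lam)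
    (L : ResGLnCohomology.CoeffModule ℂ 2 K D.lam →ₗ[ℂ] ℂ) : (AdelicGroupData.gl 2 K).automorphicQuotient → ℂ :=
  (AdelicGroupData.gl 2 K).descend (mulChar (detTwist 2 T.χ) (D.PsiL m L)) (mulChar_PsiL_invariant h2 hm hχκ L)

/-- `invQuot (PsiQ L) = |det|^s (L ∘ Ψ)`. [folklore] -/
theorem invQuot_PsiQ (h2 : Module.finrank ℚ K = 2) (T : UnitaryTwist D.π) {m : BigHeckeGLn.FiniteAdelicGL 2 K ⧸ ResGLnCohomology.level 2 K D.𝔫 → ResGLnCohomology.CoeffModule ℂ 2 K D.lam} (hm : D.PrimRel m)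
    (hχκ : ∀ t : ℝ≥0ˣ, ((detTwist 2 T.χ (posRealScalar 2 K t) : ℂˣ) : ℂ) = (((t : ℝ≥0) : ℝ) : ℂ) ^ centralExp D.lam) (L : ResGLnCohomology.CoeffModule ℂ 2 K D.lam →ₗ[ℂ] ℂ) :
    invQuot (AdelicGroupData.gl 2 K) (PsiQ h2 T hm hχκ L) = mulChar (detTwist 2 T.χ) (D.PsiL m L) :=
  (AdelicGroupData.gl 2 K).invQuot_descend _ _

/-- Pointwise: `PsiQ L [x] = χ(det x⁻¹) L(Ψ x⁻¹)`. [folklore] -/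
theorem PsiQ_mk (h2 : Module.finrank ℚ K = 2) (T : UnitaryTwist D.π) {m : BigHeckeGLn.FiniteAdelicGL 2 K ⧸ ResGLnCohomology.level 2 K D.𝔫 → ResGLnCohomology.CoeffModule ℂ 2 K D.lam} (hm : D.PrimRel m)
    (hχκ : ∀ t : ℝ≥0ˣ, ((detTwist 2 T.χ (posRealScalar 2 K t) : ℂˣ) : ℂ) = (((t : ℝ≥0) : ℝ) : ℂ) ^ centralExp D.lam) (L : ResGLnCohomology.CoeffModule ℂ 2 K D.lam →ₗ[ℂ] ℂ) (x : (AdelicGroupData.gl 2 K).Adelic) :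
    PsiQ h2 T hm hχκ L ((AdelicGroupData.gl 2 K).toAutomorphicQuotient x) =
      ((detTwist 2 T.χ x⁻¹ : ℂˣ) : ℂ) * L (D.Psi m x⁻¹) := rfl

/-- Pointwise: `form y [x] = χ(det x⁻¹) y(x⁻¹)`. [folklore] -/
theorem form_mk (T : UnitaryTwist D.π) (y : D.π.W) (x : (AdelicGroupData.gl 2 K).Adelic) :
    T.form y ((AdelicGroupData.gl 2 K).toAutomorphicQuotient x) =
      ((detTwist 2 T.χ x⁻¹ : ℂˣ) : ℂ) * (y : (AdelicGroupData.gl 2 K).Adelic → ℂ) x⁻¹ := rfl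

/-- `PsiQ L` is continuous. [folklore] -/
theorem continuous_PsiQ (h2 : Module.finrank ℚ K = 2) (T : UnitaryTwist D.π) {m : BigHeckeGLn.FiniteAdelicGL 2 K ⧸ ResGLnCohomology.level 2 K D.𝔫 → ResGLnCohomology.CoeffModule ℂ 2 K D.lam} (hm : D.PrimRel m)
    (hχκ : ∀ t : ℝ≥0ˣ, ((detTwist 2 T.χ (posRealScalar 2 K t) : ℂˣ) : ℂ) = (((t : ℝ≥0) : ℝ) : ℂ) ^ centralExp D.lam) (L : ResGLnCohomology.CoeffModule ℂ 2 K D.lam →ₗ[ℂ] ℂ) : Continuous (PsiQ h2 T hm hχκ L) := by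
  refine continuous_of_continuous_invQuot ?_
  rw [invQuot_PsiQ]
  have : mulChar (detTwist 2 T.χ) (D.PsiL m L) = fun g => ((detTwist 2 T.χ g : ℂˣ) : ℂ) * D.PsiL m L g :=
    funext fun g => mulChar_apply _ _ _
  rw [this]
  exact (Units.continuous_val.comp (continuous_detTwist (n := 2) T.χ)).mul (D.continuous_PsiL h2 m L)

/-- Growth of `invQuot (PsiQ L)`. [folklore] -/
theorem PsiQ_growth (h2 : Module.finrank ℚ K = 2) (T : UnitaryTwist D.π) {m : BigHeckeGLn.FiniteAdelicGL 2 K ⧸ ResGLnCohomology.level 2 K D.𝔫 → ResGLnCohomology.CoeffModule ℂ 2 K D.lam} (hm : D.PrimRel m)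
    (hχκ : ∀ t : ℝ≥0ˣ, ((detTwist 2 T.χ (posRealScalar 2 K t) : ℂˣ) : ℂ) = (((t : ℝ≥0) : ℝ) : ℂ) ^ centralExp D.lam) (L : ResGLnCohomology.CoeffModule ℂ 2 K D.lam →ₗ[ℂ] ℂ) :
    ∀ C : Set (GL (Fin 2) (FiniteAdeleRing (𝓞 K) K)), IsCompact C →
      ∃ (A : ℝ) (r : ℕ), ∀ g' : (AdelicGroupData.gl 2 K).Adelic, GLn.sndHom 2 K g' ∈ C →
        ‖invQuot (AdelicGroupData.gl 2 K) (PsiQ h2 T hm hχκ L) g'‖ ≤ A * (1 ⊔ (GLn.archHeight 2 K g' : ℝ)) ^ r := by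
  intro C hC
  rw [invQuot_PsiQ]
  exact D.PsiL_twist_archModerateGrowth h2 m T.hχ L C hC

/-- `\overline{PsiQ L} · form y` is integrable. [cite: Borel1997, 11.12] -/
theorem integrable_PsiQ_form (h2 : Module.finrank ℚ K = 2) (T : UnitaryTwist D.π) (μ : Measure (AdelicGroupData.gl 2 K).automorphicQuotient) [(AdelicGroupData.gl 2 K).IsAutomorphicMeasure μ] {m : BigHeckeGLn.FiniteAdelicGL 2 K ⧸ ResGLnCohomology.level 2 K D.𝔫 → ResGLnCohomology.CoeffModule ℂ 2 K D.lam} (hm : D.PrimRel m)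
    (hχκ : ∀ t : ℝ≥0ˣ, ((detTwist 2 T.χ (posRealScalar 2 K t) : ℂˣ) : ℂ) = (((t : ℝ≥0) : ℝ) : ℂ) ^ centralExp D.lam) (L : ResGLnCohomology.CoeffModule ℂ 2 K D.lam →ₗ[ℂ] ℂ) (y : D.π.W) :
    Integrable (fun q => conj (PsiQ h2 T hm hχκ L q) * T.form y q) μ :=
  integrable_conj_mul_cuspFormsGL (continuous_PsiQ h2 T hm hχκ L) (PsiQ_growth h2 T hm hχκ L) (T.invQuot_form_mem y)

/-- **The pairing** `B(y) = ∑_{l,m ≤ d} g_l g_m ∫ \overline{Ψ̃_{lm}} (|det|^s y_{lm})↓ dμ`.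
[cite: Harder1987, §3.1] [cite: Borel1997, 11.12] -/
def pairing (h2 : Module.finrank ℚ K = 2) (T : UnitaryTwist D.π) (μ : Measure (AdelicGroupData.gl 2 K).automorphicQuotient) [(AdelicGroupData.gl 2 K).IsAutomorphicMeasure μ] {m : BigHeckeGLn.FiniteAdelicGL 2 K ⧸ ResGLnCohomology.level 2 K D.𝔫 → ResGLnCohomology.CoeffModule ℂ 2 K D.lam} (hm : D.PrimRel m)
    (hχκ : ∀ t : ℝ≥0ˣ, ((detTwist 2 T.χ (posRealScalar 2 K t) : ℂˣ) : ℂ) = (((t : ℝ≥0) : ℝ) : ℂ) ^ centralExp D.lam) (y : model D.π.W D.d) : ℂ :=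
  ∑ l ∈ range (D.d + 1), ∑ mm ∈ range (D.d + 1), wt D.d l * wt D.d mm *
    ∫ q, conj (PsiQ h2 T hm hχκ (D.coordLM l mm) q) * T.form ((y : ℕ → ℕ → D.π.W) l mm) q ∂μ

/-- The pairing is additive. [folklore] -/
theorem pairing_add (h2 : Module.finrank ℚ K = 2) (T : UnitaryTwist D.π) (μ : Measure (AdelicGroupData.gl 2 K).automorphicQuotient) [(AdelicGroupData.gl 2 K).IsAutomorphicMeasure μ] {m : BigHeckeGLn.FiniteAdelicGL 2 K ⧸ ResGLnCohomology.level 2 K D.𝔫 → ResGLnCohomology.CoeffModule ℂ 2 K D.lam} (hm : D.PrimRel m)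
    (hχκ : ∀ t : ℝ≥0ˣ, ((detTwist 2 T.χ (posRealScalar 2 K t) : ℂˣ) : ℂ) = (((t : ℝ≥0) : ℝ) : ℂ) ^ centralExp D.lam) (y y' : model D.π.W D.d) :
    pairing h2 T μ hm hχκ (y + y') = pairing h2 T μ hm hχκ y + pairing h2 T μ hm hχκ y' := by
  simp only [pairing, ← Finset.sum_add_distrib, ← mul_add]
  refine Finset.sum_congr rfl fun l _ => Finset.sum_congr rfl fun mm _ => ?_
  congr 1
  rw [← integral_add (integrable_PsiQ_form (μ := μ) h2 T hm hχκ _ _) (integrable_PsiQ_form (μ := μ) h2 T hm hχκ _ _)]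
  refine integral_congr_ae (ae_of_all _ fun q => ?_)
  simp only [Submodule.coe_add, Pi.add_apply, T.form_add, mul_add]

/-- The pairing as an additive map (the `Ψ ∈ H'` of `Kuga.Setup.eq_zero_of_pairedPrimitive`). [folklore] -/
def pairingHom (h2 : Module.finrank ℚ K = 2) (T : UnitaryTwist D.π) (μ : Measure (AdelicGroupData.gl 2 K).automorphicQuotient) [(AdelicGroupData.gl 2 K).IsAutomorphicMeasure μ] {m : BigHeckeGLn.FiniteAdelicGL 2 K ⧸ ResGLnCohomology.level 2 K D.𝔫 → ResGLnCohomology.CoeffModule ℂ 2 K D.lam} (hm : D.PrimRel m)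
    (hχκ : ∀ t : ℝ≥0ˣ, ((detTwist 2 T.χ (posRealScalar 2 K t) : ℂˣ) : ℂ) = (((t : ℝ≥0) : ℝ) : ℂ) ^ centralExp D.lam) : model D.π.W D.d →+ ℂ :=
  AddMonoidHom.mk' (pairing h2 T μ hm hχκ) (pairing_add h2 T μ hm hχκ)

/-! ### The primitive equation `⟪η_i, y⟫ = −B(π_i y) + B(ρ_i y)` -/

variable (D) in
/-- The functional `u ↦ ((ρ_E ⊗ 1)(x_i) Θ⁻¹ u)_{l,m}`. [folklore] -/
def Lρ (i : Fin 3) (l mm : ℕ) : ResGLnCohomology.CoeffModule ℂ 2 K D.lam →ₗ[ℂ] ℂ :=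
  ((LinearMap.proj mm).comp (LinearMap.proj l)).comp ((model ℂ D.d).subtype.comp
    (((coeff (C := ℂ) D.d).pVec i).comp (D.Θ.symm : _ →ₗ[ℂ] model ℂ D.d)))

/-- Unfolding. [folklore] -/
theorem Lρ_apply (i : Fin 3) (l mm : ℕ) (u : ResGLnCohomology.CoeffModule ℂ 2 K D.lam) :
    D.Lρ i l mm u = ((((coeff (C := ℂ) D.d).pVec i (D.Θ.symm u) : model ℂ D.d) : ℕ → ℕ → ℂ) l mm) := rfl

/-- **`|det|^s η_i = X_i (|det|^s Ψ_{lm}) + |det|^s ((ρ_E ⊗ 1)(x_i) Ψ)_{lm}`** as functions on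
`GL₂(𝔸_K)`. [cite: Harder1987, §3.1] -/
theorem mulChar_eta_eq (h2 : Module.finrank ℚ K = 2) (T : UnitaryTwist D.π)
    (m : BigHeckeGLn.FiniteAdelicGL 2 K ⧸ ResGLnCohomology.level 2 K D.𝔫 → ResGLnCohomology.CoeffModule ℂ 2 K D.lam)
    (i : Fin 3) (l mm : ℕ) :
    mulChar (detTwist 2 T.χ) ((((D.η i : ℕ → ℕ → D.π.W) l mm : D.π.W) : (AdelicGroupData.gl 2 K).Adelic → ℂ)) =
      lieDeriv (AutomorphyDatum.gl 2 K hcpt).ofArch (placeLie 2 (complexPlace K) (Xmat i))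
          (mulChar (detTwist 2 T.χ) (D.PsiL m (D.coordLM l mm))) +
        mulChar (detTwist 2 T.χ) (D.PsiL m (D.Lρ i l mm)) := by
  rw [D.lieDeriv_mulChar_PsiL h2 m T.hχ (D.coordLM l mm) i]
  funext x
  rw [Pi.add_apply, mulChar_apply, mulChar_apply, mulChar_apply, PsiL_apply, map_sub, coordLM_vec_Xmat,
    coordLM_coeffPlaceLie_Xmat, Lρ_apply]
  ring

/-- **One entry of the primitive equation**: `⟪η_{i,lm}, w⟫ = −∫ P̄_{lm} (ρ₁(x_i) w)↓ + ∫ R̄_{lm} w↓`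
with `P_{lm} = PsiQ (coordLM l m)`, `R_{lm} = PsiQ (Lρ i l m)` — Borel's integration by parts.
[cite: Borel1997, 11.12] [cite: Harder1987, §3.1] -/
theorem pet_eta_entry_eq (h2 : Module.finrank ℚ K = 2) (T : UnitaryTwist D.π) (μ : Measure (AdelicGroupData.gl 2 K).automorphicQuotient) [(AdelicGroupData.gl 2 K).IsAutomorphicMeasure μ] {m : BigHeckeGLn.FiniteAdelicGL 2 K ⧸ ResGLnCohomology.level 2 K D.𝔫 → ResGLnCohomology.CoeffModule ℂ 2 K D.lam} (hm : D.PrimRel m)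
    (hχκ : ∀ t : ℝ≥0ˣ, ((detTwist 2 T.χ (posRealScalar 2 K t) : ℂˣ) : ℂ) = (((t : ℝ≥0) : ℝ) : ℂ) ^ centralExp D.lam) (i : Fin 3) (l mm : ℕ) (yl : D.π.W) :
    T.pet μ ((D.η i : ℕ → ℕ → D.π.W) l mm) yl =
      -(∫ q, conj (PsiQ h2 T hm hχκ (D.coordLM l mm) q) * T.form (D.ρ₁ (Xmat i) yl) q ∂μ) +
        ∫ q, conj (PsiQ h2 T hm hχκ (D.Lρ i l mm) q) * T.form yl q ∂μ := by
  obtain ⟨lam, -, hlam⟩ := exists_normExponent (n := 2) (K := K) hcpt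
  haveI : FiniteDimensional ℝ (mixedSpace K) := inferInstance
  set Xi : (AutomorphyDatum.gl 2 K hcpt).arch.lie := placeLie 2 (complexPlace K) (Xmat i) with hXi
  set φ : D.π.W := (D.η i : ℕ → ℕ → D.π.W) l mm with hφ
  set P : (AdelicGroupData.gl 2 K).automorphicQuotient → ℂ := PsiQ h2 T hm hχκ (D.coordLM l mm) with hP
  set R : (AdelicGroupData.gl 2 K).automorphicQuotient → ℂ := PsiQ h2 T hm hχκ (D.Lρ i l mm) with hR
  -- `f_X := form η − R`
  set FX : (AdelicGroupData.gl 2 K).automorphicQuotient → ℂ := T.form φ - R with hFX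
  have e1 : invQuot (AdelicGroupData.gl 2 K) FX =
      invQuot (AdelicGroupData.gl 2 K) (T.form φ) - invQuot (AdelicGroupData.gl 2 K) R := rfl
  have hinvFX : invQuot (AdelicGroupData.gl 2 K) FX =
      lieDeriv (AutomorphyDatum.gl 2 K hcpt).ofArch Xi (invQuot (AdelicGroupData.gl 2 K) P) := by
    rw [e1, T.invQuot_form, hR, invQuot_PsiQ, hP, invQuot_PsiQ, mulChar_eta_eq h2 T m i l mm, add_sub_cancel_right]
  have hFXm : ∀ C : Set (GL (Fin 2) (FiniteAdeleRing (𝓞 K) K)), IsCompact C →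
      ∃ (A : ℝ) (r : ℕ), ∀ g' : (AdelicGroupData.gl 2 K).Adelic, GLn.sndHom 2 K g' ∈ C →
        ‖invQuot (AdelicGroupData.gl 2 K) FX g'‖ ≤ A * (1 ⊔ (GLn.archHeight 2 K g' : ℝ)) ^ r := by
    intro C hC
    rw [e1, T.invQuot_form, hR, invQuot_PsiQ]
    refine archMG_sub (fun C' hC' => ?_) (fun C' hC' => D.PsiL_twist_archModerateGrowth h2 m T.hχ _ C' hC') C hC
    exact archModerateGrowth_of_hasModerateGrowth two_pos
      (isAutomorphicForm_of_mem_automorphicForms_gl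
        (cuspFormsGL_le_automorphicForms 2 K hcpt (T.cusp _ φ.2))).moderateGrowth C' hC'
  have hPs : IsArchSmooth (AutomorphyDatum.gl 2 K hcpt).ofArch (invQuot (AdelicGroupData.gl 2 K) P) := by
    rw [hP, invQuot_PsiQ]
    exact isArchSmooth_mulChar_of_exp _ (detTwist_ofArch_expMem_eq_exp_smul T.hχ hlam) (D.isArchSmooth_PsiL h2 m _)
  have hXg : lieDeriv (AutomorphyDatum.gl 2 K hcpt).ofArch Xi (invQuot (AdelicGroupData.gl 2 K) (T.form yl)) =
      invQuot (AdelicGroupData.gl 2 K) (T.form (D.ρ₁ (Xmat i) yl)) := by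
    rw [T.invQuot_form, T.invQuot_form]; exact D.lieDeriv_mulChar_W T.hχ i yl
  -- Borel's integration by parts
  have hparts := integral_conj_lieDeriv_mul_add_eq_zero_cuspFormsGL_of_archModerateGrowth (μ := μ) two_pos Xi
    (continuous_PsiQ h2 T hm hχκ _) ((T.continuous_form φ).1.sub (continuous_PsiQ h2 T hm hχκ _))
    (PsiQ_growth h2 T hm hχκ _) hFXm hPs hinvFX.symm (T.invQuot_form_mem yl) hXg
  -- `pet = ∫ conj(FX + R) g = ∫ conj FX g + ∫ conj R g`
  have hI2 := integrable_PsiQ_form (μ := μ) h2 T hm hχκ (D.Lρ i l mm) yl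
  have hI1 : Integrable (fun q => conj (FX q) * T.form yl q) μ := by
    refine ((T.integrable_conj_mul μ φ yl).sub hI2).congr (ae_of_all _ fun q => ?_)
    simp only [hFX, Pi.sub_apply, map_sub, sub_mul, hR]
  have hsplit : T.pet μ φ yl = (∫ q, conj (FX q) * T.form yl q ∂μ) + ∫ q, conj (R q) * T.form yl q ∂μ := by
    rw [← integral_add hI1 hI2]
    refine integral_congr_ae (ae_of_all _ fun q => ?_)
    simp only [hFX, Pi.sub_apply, map_sub, sub_mul, hR]
    ring
  rw [hsplit, eq_neg_of_add_eq_zero_left hparts]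

/-- **Admissibility of `ρ_E`, pointwise on the quotient**: at `[x]`,
`∑ g_l g_m R̄_{lm} y_{lm}↓ = ∑ g_l g_m P̄_{lm} (ρ(x_i) y)_{lm}↓`. [cite: BorelWallach2000, II §2.2] -/
theorem rho_pointwise (h2 : Module.finrank ℚ K = 2) (T : UnitaryTwist D.π) {m : BigHeckeGLn.FiniteAdelicGL 2 K ⧸ ResGLnCohomology.level 2 K D.𝔫 → ResGLnCohomology.CoeffModule ℂ 2 K D.lam} (hm : D.PrimRel m)
    (hχκ : ∀ t : ℝ≥0ˣ, ((detTwist 2 T.χ (posRealScalar 2 K t) : ℂˣ) : ℂ) = (((t : ℝ≥0) : ℝ) : ℂ) ^ centralExp D.lam) (i : Fin 3) (y : model D.π.W D.d) (x : (AdelicGroupData.gl 2 K).Adelic) :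
    (∑ l ∈ range (D.d + 1), ∑ mm ∈ range (D.d + 1), wt D.d l * wt D.d mm *
        (conj (PsiQ h2 T hm hχκ (D.Lρ i l mm) ((AdelicGroupData.gl 2 K).toAutomorphicQuotient x)) *
          T.form ((y : ℕ → ℕ → D.π.W) l mm) ((AdelicGroupData.gl 2 K).toAutomorphicQuotient x))) =
      ∑ l ∈ range (D.d + 1), ∑ mm ∈ range (D.d + 1), wt D.d l * wt D.d mm *
        (conj (PsiQ h2 T hm hχκ (D.coordLM l mm) ((AdelicGroupData.gl 2 K).toAutomorphicQuotient x)) *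
          T.form (((D.setup.ρp i y : model D.π.W D.d) : ℕ → ℕ → D.π.W) l mm) ((AdelicGroupData.gl 2 K).toAutomorphicQuotient x)) := by
  set z := x⁻¹ with hz
  set cz : ℂ := ((detTwist 2 T.χ z : ℂˣ) : ℂ) with hcz
  set a : model ℂ D.d := D.arr m z with ha
  set b : model ℂ D.d := mapModel D.d (D.evalW z) y with hb
  have eR : ∀ l mm, PsiQ h2 T hm hχκ (D.Lρ i l mm) ((AdelicGroupData.gl 2 K).toAutomorphicQuotient x) =
      cz * ((((coeff (C := ℂ) D.d).pVec i a : model ℂ D.d) : ℕ → ℕ → ℂ) l mm) := fun l mm => rfl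
  have eP : ∀ l mm, PsiQ h2 T hm hχκ (D.coordLM l mm) ((AdelicGroupData.gl 2 K).toAutomorphicQuotient x) =
      cz * ((a : ℕ → ℕ → ℂ) l mm) := fun l mm => rfl
  have ey : ∀ l mm, T.form ((y : ℕ → ℕ → D.π.W) l mm) ((AdelicGroupData.gl 2 K).toAutomorphicQuotient x) =
      cz * ((b : ℕ → ℕ → ℂ) l mm) := fun l mm => rfl
  have eρ : ∀ l mm, T.form (((D.setup.ρp i y : model D.π.W D.d) : ℕ → ℕ → D.π.W) l mm)
      ((AdelicGroupData.gl 2 K).toAutomorphicQuotient x) =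
        cz * ((((coeff (C := ℂ) D.d).pVec i b : model ℂ D.d) : ℕ → ℕ → ℂ) l mm) := fun l mm => by
    rw [form_mk]
    congr 1
    have := congrArg (fun u : model ℂ D.d => (u : ℕ → ℕ → ℂ) l mm) ((intertwines_mapModel_coeff D.d (D.evalW z)).pVec i y)
    simp only [mapModel_apply, evalW_apply] at this
    rw [hb, ← this]
    rfl
  simp only [eR, eP, ey, eρ, map_mul]
  have key := ipModel_pVec_coeff_symm D.d i a b
  simp only [ipModel] at key
  calc ∑ l ∈ range (D.d + 1), ∑ mm ∈ range (D.d + 1), wt D.d l * wt D.d mm *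
        (conj cz * conj ((((coeff (C := ℂ) D.d).pVec i a : model ℂ D.d) : ℕ → ℕ → ℂ) l mm) * (cz * (b : ℕ → ℕ → ℂ) l mm))
      = conj cz * cz * ∑ l ∈ range (D.d + 1), ∑ mm ∈ range (D.d + 1), wt D.d l * wt D.d mm *
          (conj ((((coeff (C := ℂ) D.d).pVec i a : model ℂ D.d) : ℕ → ℕ → ℂ) l mm) * (b : ℕ → ℕ → ℂ) l mm) := by
        rw [Finset.mul_sum]
        refine Finset.sum_congr rfl fun l _ => ?_
        rw [Finset.mul_sum]
        refine Finset.sum_congr rfl fun mm _ => by ring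
    _ = conj cz * cz * ∑ l ∈ range (D.d + 1), ∑ mm ∈ range (D.d + 1), wt D.d l * wt D.d mm *
          (conj ((a : ℕ → ℕ → ℂ) l mm) * ((((coeff (C := ℂ) D.d).pVec i b : model ℂ D.d) : ℕ → ℕ → ℂ) l mm)) := by
        rw [key]
    _ = _ := by
        rw [Finset.mul_sum]
        refine Finset.sum_congr rfl fun l _ => ?_
        rw [Finset.mul_sum]
        refine Finset.sum_congr rfl fun mm _ => by ring

/-- A weighted double sum of integrals of `\overline{PsiQ} · form` is the integral of the sum. [folklore] -/
theorem sum_integral_eq (h2 : Module.finrank ℚ K = 2) (T : UnitaryTwist D.π) (μ : Measure (AdelicGroupData.gl 2 K).automorphicQuotient) [(AdelicGroupData.gl 2 K).IsAutomorphicMeasure μ] {m : BigHeckeGLn.FiniteAdelicGL 2 K ⧸ ResGLnCohomology.level 2 K D.𝔫 → ResGLnCohomology.CoeffModule ℂ 2 K D.lam} (hm : D.PrimRel m)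
    (hχκ : ∀ t : ℝ≥0ˣ, ((detTwist 2 T.χ (posRealScalar 2 K t) : ℂˣ) : ℂ) = (((t : ℝ≥0) : ℝ) : ℂ) ^ centralExp D.lam) (L : ℕ → ℕ → (ResGLnCohomology.CoeffModule ℂ 2 K D.lam →ₗ[ℂ] ℂ)) (w : ℕ → ℕ → D.π.W) :
    (∑ l ∈ range (D.d + 1), ∑ mm ∈ range (D.d + 1), wt D.d l * wt D.d mm *
        ∫ q, conj (PsiQ h2 T hm hχκ (L l mm) q) * T.form (w l mm) q ∂μ) =
      ∫ q, ∑ l ∈ range (D.d + 1), ∑ mm ∈ range (D.d + 1), wt D.d l * wt D.d mm *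
        (conj (PsiQ h2 T hm hχκ (L l mm) q) * T.form (w l mm) q) ∂μ := by
  have hI : ∀ l mm, Integrable (fun q => wt D.d l * wt D.d mm * (conj (PsiQ h2 T hm hχκ (L l mm) q) * T.form (w l mm) q)) μ :=
    fun l mm => (integrable_PsiQ_form (μ := μ) h2 T hm hχκ (L l mm) (w l mm)).const_mul _
  rw [integral_finsetSum _ fun l _ => integrable_finsetSum _ fun mm _ => hI l mm]
  refine Finset.sum_congr rfl fun l _ => ?_
  rw [integral_finsetSum _ fun mm _ => hI l mm]
  refine Finset.sum_congr rfl fun mm _ => ?_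
  rw [integral_const_mul]

/-- **The primitive equation, integrated**: for `y ∈ W ⊗ Sym^d ⊗ \overline{Sym}^d`,
`⟪η_i, y⟫ = −B(π(x_i) y) + B(ρ(x_i) y)` — Borel's integration by parts for the first term,
admissibility of `ρ_E` for the second. [cite: Harder1987, §3.1] [cite: Borel1997, 11.12] -/
theorem ipModel_eta_eq (h2 : Module.finrank ℚ K = 2) (T : UnitaryTwist D.π) (μ : Measure (AdelicGroupData.gl 2 K).automorphicQuotient) [(AdelicGroupData.gl 2 K).IsAutomorphicMeasure μ] {m : BigHeckeGLn.FiniteAdelicGL 2 K ⧸ ResGLnCohomology.level 2 K D.𝔫 → ResGLnCohomology.CoeffModule ℂ 2 K D.lam} (hm : D.PrimRel m)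
    (hχκ : ∀ t : ℝ≥0ˣ, ((detTwist 2 T.χ (posRealScalar 2 K t) : ℂˣ) : ℂ) = (((t : ℝ≥0) : ℝ) : ℂ) ^ centralExp D.lam) (i : Fin 3) (y : model D.π.W D.d) :
    ipModel D.d (T.pet μ) (D.η i) y =
      -pairing h2 T μ hm hχκ (D.setup.πp i y) + pairing h2 T μ hm hχκ (D.setup.ρp i y) := by
  have hip : ipModel D.d (T.pet μ) (D.η i) y =
      ∑ l ∈ range (D.d + 1), ∑ mm ∈ range (D.d + 1), wt D.d l * wt D.d mm *
        T.pet μ ((D.η i : ℕ → ℕ → D.π.W) l mm) ((y : ℕ → ℕ → D.π.W) l mm) := rfl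
  have hπsum : (∑ l ∈ range (D.d + 1), ∑ mm ∈ range (D.d + 1), wt D.d l * wt D.d mm *
      ∫ q, conj (PsiQ h2 T hm hχκ (D.coordLM l mm) q) * T.form (D.ρ₁ (Xmat i) ((y : ℕ → ℕ → D.π.W) l mm)) q ∂μ) =
      pairing h2 T μ hm hχκ (D.setup.πp i y) := by
    rw [pairing]
    refine Finset.sum_congr rfl fun l _ => Finset.sum_congr rfl fun mm _ => ?_
    have hπ : D.ρ₁ (Xmat i) ((y : ℕ → ℕ → D.π.W) l mm) = ((D.setup.πp i y : model D.π.W D.d) : ℕ → ℕ → D.π.W) l mm := by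
      have := congrArg (fun u : model D.π.W D.d => (u : ℕ → ℕ → D.π.W) l mm) (D.mapModel_ρ₁_Xmat i y)
      simp only [mapModel_apply] at this
      exact this
    rw [hπ]
  have hρsum : (∑ l ∈ range (D.d + 1), ∑ mm ∈ range (D.d + 1), wt D.d l * wt D.d mm *
      ∫ q, conj (PsiQ h2 T hm hχκ (D.Lρ i l mm) q) * T.form ((y : ℕ → ℕ → D.π.W) l mm) q ∂μ) =
      pairing h2 T μ hm hχκ (D.setup.ρp i y) := by
    rw [pairing, sum_integral_eq h2 T μ hm hχκ (fun l mm => D.Lρ i l mm) (fun l mm => (y : ℕ → ℕ → D.π.W) l mm),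
      sum_integral_eq h2 T μ hm hχκ (fun l mm => D.coordLM l mm)
        (fun l mm => ((D.setup.ρp i y : model D.π.W D.d) : ℕ → ℕ → D.π.W) l mm)]
    refine integral_congr_ae (ae_of_all _ fun q => ?_)
    obtain ⟨x, rfl⟩ := QuotientGroup.mk_surjective q
    exact rho_pointwise h2 T hm hχκ i y x
  rw [hip, Finset.sum_congr rfl fun l _ => Finset.sum_congr rfl fun mm _ => by
    rw [pet_eta_entry_eq h2 T μ hm hχκ i l mm, mul_add, mul_neg]]
  rw [Finset.sum_congr rfl fun l _ => Finset.sum_add_distrib, Finset.sum_add_distrib]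
  simp only [Finset.sum_neg_distrib]
  rw [hπsum, hρsum]

/-- `Ψ' ↦ (y ↦ −Ψ'(π(x_i) y))` on the bookkeeping space `H' = Hom(H, ℂ)`. [folklore] -/
def negPre (i : Fin 3) (Ψ' : model D.π.W D.d →+ ℂ) : model D.π.W D.d →+ ℂ :=
  AddMonoidHom.mk' (fun y => -Ψ' (D.setup.πp i y)) fun a b => by rw [map_add, map_add, neg_add]

/-- `Ψ' ↦ (y ↦ Ψ'(ρ(x_i) y))` on `H' = Hom(H, ℂ)`. [folklore] -/
def rhoPre (i : Fin 3) (Ψ' : model D.π.W D.d →+ ℂ) : model D.π.W D.d →+ ℂ :=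
  AddMonoidHom.mk' (fun y => Ψ' (D.setup.ρp i y)) fun a b => by rw [map_add, map_add]

/-- Unfolding. [folklore] -/
theorem negPre_apply (i : Fin 3) (Ψ' : model D.π.W D.d →+ ℂ) (y : model D.π.W D.d) :
    negPre (D := D) i Ψ' y = -Ψ' (D.setup.πp i y) := rfl

/-- Unfolding. [folklore] -/
theorem rhoPre_apply (i : Fin 3) (Ψ' : model D.π.W D.d →+ ℂ) (y : model D.π.W D.d) :
    rhoPre (D := D) i Ψ' y = Ψ' (D.setup.ρp i y) := rfl

/-- Unfolding. [folklore] -/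
theorem pairingHom_apply (h2 : Module.finrank ℚ K = 2) (T : UnitaryTwist D.π) (μ : Measure (AdelicGroupData.gl 2 K).automorphicQuotient) [(AdelicGroupData.gl 2 K).IsAutomorphicMeasure μ] {m : BigHeckeGLn.FiniteAdelicGL 2 K ⧸ ResGLnCohomology.level 2 K D.𝔫 → ResGLnCohomology.CoeffModule ℂ 2 K D.lam} (hm : D.PrimRel m)
    (hχκ : ∀ t : ℝ≥0ˣ, ((detTwist 2 T.χ (posRealScalar 2 K t) : ℂˣ) : ℂ) = (((t : ℝ≥0) : ℝ) : ℂ) ^ centralExp D.lam) (y : model D.π.W D.d) : pairingHom h2 T μ hm hχκ y = pairing h2 T μ hm hχκ y := rfl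

/-- **A primitive relation forces `η = 0`** (Kuga's paired-primitive argument with the pairing
`pairingHom`). [cite: Harder1987, §3.1] [cite: BorelWallach2000, II Prop. 2.5] -/
theorem eta_eq_zero_of_primRel (h2 : Module.finrank ℚ K = 2) (T : UnitaryTwist D.π) (μ : Measure (AdelicGroupData.gl 2 K).automorphicQuotient) [(AdelicGroupData.gl 2 K).IsAutomorphicMeasure μ] {m : BigHeckeGLn.FiniteAdelicGL 2 K ⧸ ResGLnCohomology.level 2 K D.𝔫 → ResGLnCohomology.CoeffModule ℂ 2 K D.lam} (hm : D.PrimRel m)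
    (hχκ : ∀ t : ℝ≥0ˣ, ((detTwist 2 T.χ (posRealScalar 2 K t) : ℂˣ) : ℂ) = (((t : ℝ≥0) : ℝ) : ℂ) ^ centralExp D.lam) (hδ : D.setup.deltaOne D.η = 0) : D.η = 0 := by
  refine Kuga.Setup.eq_zero_of_pairedPrimitive (S := D.setup) (ip := ipModel D.d (T.pet μ)) (H' := model D.π.W D.d →+ ℂ)
    (B := fun Ψ' y => Ψ' y) (isPosForm_ipModel D.d (T.isPosForm_pet μ)) (fun Ψ' x y => map_add Ψ' x y)
    (negPre (D := D)) (rhoPre (D := D)) (fun i Ψ' y => negPre_apply i Ψ' y) (fun i Ψ' y => rhoPre_apply i Ψ' y) hδ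
    (Ψ := pairingHom h2 T μ hm hχκ) fun i y => ?_
  rw [negPre_apply, rhoPre_apply, pairingHom_apply, pairingHom_apply]
  exact ipModel_eta_eq h2 T μ hm hχκ i y

end Pairing

/-! ### Non-vanishing of the van Est class -/

omit [IsTotallyComplex K] in
/-- `E_λ(ℂ)` is complete (finite-dimensional). [folklore] -/
theorem completeSpace_coeffModule (lam : (K →+* ℂ) → Fin 2 → ℤ) :
    CompleteSpace (ResGLnCohomology.CoeffModule ℂ 2 K lam) :=
  FiniteDimensional.complete ℂ _

attribute [local instance] completeSpace_coeffModule

/-- **Harder's non-vanishing in Borel's form.** Let `D` be the family data of a clean cuspidal `π`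
of `GL₂` over an imaginary quadratic field with `δη = 0`, `T` a unitary twist `|det|^s` of `π`
with `χ(det a) = a^{κ}` on `A_G` (`κ` the central exponent of `E_λ(ℂ)`), `μ` an automorphic
measure. If the van Est class of the Eichler–Shimura–Harder family vanishes in
`H¹(S_{K_f}, E_λ(ℂ))`, then `η = 0`. [cite: Harder1987, §3.1–3.2] [cite: Borel1997, 11.12]
[cite: BorelWallach2000, II Prop. 2.5 and VII §2.2] -/
theorem eta_eq_zero_of_vanEstClass_eq_zero (h2 : Module.finrank ℚ K = 2) (T : UnitaryTwist D.π)
    (μ : Measure (AdelicGroupData.gl 2 K).automorphicQuotient) [(AdelicGroupData.gl 2 K).IsAutomorphicMeasure μ]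
    (hχκ : ∀ t : ℝ≥0ˣ, ((detTwist 2 T.χ (posRealScalar 2 K t) : ℂˣ) : ℂ) = (((t : ℝ≥0) : ℝ) : ℂ) ^ centralExp D.lam)
    (hδ : D.setup.deltaOne D.η = 0) (h0 : GL2C.vanEstClass (D.isAutomorphicFamily h2) = 0) : D.η = 0 := by
  obtain ⟨m, hm⟩ := GL2C.exists_automorphic_primitive_of_vanEstClass_eq_zero (D.isAutomorphicFamily h2) h0
  exact eta_eq_zero_of_primRel h2 T μ (m := m) hm hχκ hδ

/-- **The van Est class of a non-zero Eichler–Shimura–Harder cochain is non-zero.**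
[cite: Harder1987, §3.2] [cite: Borel1997, 11.12] -/
theorem vanEstClass_ne_zero (h2 : Module.finrank ℚ K = 2) (T : UnitaryTwist D.π)
    (μ : Measure (AdelicGroupData.gl 2 K).automorphicQuotient) [(AdelicGroupData.gl 2 K).IsAutomorphicMeasure μ]
    (hχκ : ∀ t : ℝ≥0ˣ, ((detTwist 2 T.χ (posRealScalar 2 K t) : ℂˣ) : ℂ) = (((t : ℝ≥0) : ℝ) : ℂ) ^ centralExp D.lam)
    (hδ : D.setup.deltaOne D.η = 0) (hne : D.η 0 ≠ 0) : GL2C.vanEstClass (D.isAutomorphicFamily h2) ≠ 0 := fun h0 =>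
  hne (by rw [D.eta_eq_zero_of_vanEstClass_eq_zero h2 T μ hχκ hδ h0]; rfl)

end FamilyData

end GL2CESH

end Literature.NumberTheory.Automorphic

end
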